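import Literature.IUT.LogThetaLattice.GlobalLGPFrobenioidsRealifiedPlaces
import Literature.IUT.LogThetaLattice.GlobalLGPFrobenioidsModFrakRealifiedDivisors
import Literature.IUT.HodgeTheaters.GlobalFrobenioidsRealifyProofs
import HarnessLib

/-!
# [IUTchI] Ex 3.5 (i) `Φ_{𝒞⊩_mod}`: the layer-L6 identification `effDivEquivPhiMod` versus the layer-L1/L5 realification
# map `realifyMod` — the two differ by the absolute ramification index `e_v` at each finite place (PROOF-ONLY certificate)

S. Mochizuki, *Inter-universal Teichmüller theory I*, §3, Example 3.5 (i), kurims manuscript (May 2020) p. 84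
([IUTchI] Ex 3.5 (i) p.84) [claim: Mochizuki2012, status: disputed]: "`Φ_{𝒞⊩_mod,v} ≅ ord(𝒪^▷_{(F_mod)_v})^pf ⊗ ℝ_{≥0}`",
"each element `p_v ∈ (F_mod)_v` determines an element `log⊢_mod(p_v) ∈ Φ_{𝒞⊩_mod,v}`" (and §0: `ord_v(p_v) = e_v`, the
absolute ramification index); S. Mochizuki, *The geometry of Frobenioids I*, Kyushu J. Math. **62** (2008), Ex. 6.3 p. 113
(`Φ(L) = ⊕_v ord(O_v^▷)`, the prime divisor `[v]` generating `ord(O_v^▷) ≅ ℤ_{≥0}` at a finite `v`)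
[cite: MochizukiFrdI2008, Ex. 6.3 p.113].

PROOF-ONLY (no `def`, no instance; abc-iut-w4-d073 gen 4; cross-layer merge-debt certificate, neutral).  The tree holds
TWO identifications of a divisor monoid with abc-iut-L5-t2's `Φ_{𝒞⊩_mod} = (V(F) →₀ ℝ_{≥0})` (`InitialThetaData.PhiMod`,
coordinate convention "`log⊢_mod(p_v) ↦ 1`", `InitialThetaData.logMod v = single v 1`):
* layer L1/L5: `EffArithDivisor.realifyMod F : Φ(F) = EffArithDivisor F → (V(F) →₀ ℝ_{≥0})` (abc-iut-w4-d050,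
  `GlobalFrobenioidsRealify.lean`): the prime divisor `[v]` goes to `e_v⁻¹ ·` (unit vector at `v`), so that
  `div_v(p_v) = e_v · [v] ↦ log⊢_mod(p_v)` (`realifyMod_single_absRamIdx`, `realifyMod_logMod`); extended to THE isomorphism
  `Φ(F)^rlf ≃* Φ_{𝒞⊩_mod}` in `GlobalFrobenioidsRealifyRlfEquiv.lean` (abc-iut-w4-d073);
* layer L6: `Prop37.FrakRlfCat.effDivAddEquivVal F : Φ^rlf(∗) = effDiv (ModelPlaces F) ℝ ≃+ (V(F) →₀ ℝ_{≥0})`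
  (abc-iut-w5-d153, `GlobalLGPFrobenioidsRealifiedPlaces.lean`; at `F_mod` it is `effDivEquivPhiMod`): plain reindexing of
  the classes, `δ_𝔭 ↦ single v 1 = logMod v` (`effDivAddEquivVal_delta`, `effDivEquivPhiMod_delta`), where `δ_𝔭` is the family
  of class `1` at `𝔭` — the realification `realifyEff (effDivOfArith [v])` of the prime divisor `[v]` (abc-iut-w4-d005/d015:
  `realifyCls` casts the integer class `ℤ ↪ ℝ`; `frakDeg` of class `λ` at `𝔭` is `∓ λ · log N(𝔭)`).

THIS FILE computes the composite of the L6 route `Φ(F) → Φ(∗) → Φ^ℝ(∗) → (V(F) →₀ ℝ_{≥0})`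
(`effDivOfArith`, `realifyEff`, `effDivAddEquivVal`) coordinatewise and compares it with `realifyMod`:
* `effDivAddEquivVal_realifyEff_effDivOfArith_apply_inl / _apply_inr` — archimedean coordinate `x_v`, finite
  coordinate `n_v` (NO division by `e_v`);
* `…_apply_inr_eq_absRamIdx_mul_realifyMod` — at a finite `v` the L6 route is `e_v ·` the L1/L5 route; they agree at
  archimedean places (`…_apply_inl_eq_realifyMod`);
* `…_single_inr` versus `realifyMod_single_inr` — on the prime divisor `[v]`: `single v 1` (L6) versus `single v e_v⁻¹`
  (L1/L5); hence `…_eq_realifyMod_iff`: the two maps agree on `a ∈ Φ(F)` iff `e_v = 1` at every finite place in the support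
  of `a`, and `…_single_inr_ne_realifyMod` — they DIFFER on `[v]` whenever `e_v ≠ 1`;
* at the field of moduli of an initial Θ-datum: `effDivEquivPhiMod_realifyEff_effDivOfArith_single_inr` (`[v] ↦ logMod v`
  under the L6 identification) next to abc-iut-w4-d050's `realifyMod_logMod` (`e_v · [v] ↦ logMod v` under the L1/L5 one).
Which normalisation a consumer of `effDivEquivPhiMod` / `rhoLgp` composed with abc-iut-L5-t2's `ρ_v` scalars intends is for
the layer leads / referees; this file only certifies the factor.  No new Prop fact; no statement of the paper is
strengthened; no side is taken on [IUTchIII] Cor. 3.12.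
-/

noncomputable section

namespace Literature.IUT.LogThetaLattice

namespace Prop37

namespace FrakRlfCat

open NumberField IsDedekindDomain GlobalFrobenioidModels Literature.AlgebraicGeometry.Frobenioids
  Literature.IUT.HodgeTheaters
open scoped NNReal

variable (F : Type) [Field F] [NumberField F]

/-! ### The L6 route `Φ(F) → Φ(∗) → Φ^ℝ(∗) → (V(F) →₀ ℝ_{≥0})`, coordinatewise -/

/-- Archimedean coordinate of the L6 route: `x_v` (the class is kept). ([IUTchI] Ex 3.5 (i) p.84)
[claim: Mochizuki2012, status: disputed] -/
theorem effDivAddEquivVal_realifyEff_effDivOfArith_apply_inl (a : EffArithDivisor F) (v : InfinitePlace F) :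
    effDivAddEquivVal F (realifyEff F (effDivOfArith F a)) (Sum.inl v : Val F) = a.2 v := by
  apply NNReal.eq
  rw [coe_effDivAddEquivVal_apply, modelPlacesEquivVal_symm_apply]
  change (realifyObj F (effDivOfArith F a : FrakObj (Places F) (Gamma F))).cls (Sum.inr v) = ((a.2 v : ℝ≥0) : ℝ)
  rw [realifyObj_cls, realifyCls_inr, effDivOfArith_cls_inl]

/-- Finite coordinate of the L6 route: the integer coefficient `n_v` itself (cast `ℕ → ℤ → ℝ`), i.e. the prime divisor
`[v]` has coordinate `1` — NO division by `e_v`. ([IUTchI] Ex 3.5 (i) p.84) [claim: Mochizuki2012, status: disputed] -/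
theorem effDivAddEquivVal_realifyEff_effDivOfArith_apply_inr (a : EffArithDivisor F) (w : FinitePlace F) :
    effDivAddEquivVal F (realifyEff F (effDivOfArith F a)) (Sum.inr w : Val F) = (a.1 w : ℝ≥0) := by
  apply NNReal.eq
  rw [coe_effDivAddEquivVal_apply, modelPlacesEquivVal_symm_apply]
  change (realifyObj F (effDivOfArith F a : FrakObj (Places F) (Gamma F))).cls
      (Sum.inl (FinitePlace.maximalIdeal w)) = (((a.1 w : ℕ) : ℝ≥0) : ℝ)
  rw [realifyObj_cls, realifyCls_inl, FinitePlace.mk_maximalIdeal, effDivOfArith_cls_inr, Int.cast_natCast,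
    NNReal.coe_natCast]

/-! ### Comparison with the L1/L5 realification map `realifyMod` -/

/-- At an archimedean place the two routes AGREE (`x_v` on both sides). ([IUTchI] Ex 3.5 (i) p.84)
[claim: Mochizuki2012, status: disputed] -/
theorem effDivAddEquivVal_realifyEff_effDivOfArith_apply_inl_eq_realifyMod (a : EffArithDivisor F)
    (v : InfinitePlace F) :
    effDivAddEquivVal F (realifyEff F (effDivOfArith F a)) (Sum.inl v : Val F) =
      EffArithDivisor.realifyMod F a (Sum.inl v : Val F) := by
  rw [effDivAddEquivVal_realifyEff_effDivOfArith_apply_inl, realifyMod_apply_inl]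

/-- **At a finite place the L6 route is `e_v ·` the L1/L5 route**: `n_v = e_v · (n_v / e_v)`.
([IUTchI] Ex 3.5 (i) p.84) [claim: Mochizuki2012, status: disputed] -/
theorem effDivAddEquivVal_realifyEff_effDivOfArith_apply_inr_eq_absRamIdx_mul_realifyMod (a : EffArithDivisor F)
    (w : FinitePlace F) :
    effDivAddEquivVal F (realifyEff F (effDivOfArith F a)) (Sum.inr w : Val F) =
      (absRamIdx F w : ℝ≥0) * EffArithDivisor.realifyMod F a (Sum.inr w : Val F) := by
  rw [effDivAddEquivVal_realifyEff_effDivOfArith_apply_inr, realifyMod_apply_inr, mul_left_comm,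
    mul_inv_cancel₀ (absRamIdx_cast_ne_zero F w), mul_one]

/-- **The L6 route on the prime divisor `[v]`** (`v` finite): the unit vector `single v 1` — abc-iut-L5-t2's `logMod v`,
i.e. `[v] ↦ log⊢_mod(p_v)`. ([IUTchI] Ex 3.5 (i) p.84) [claim: Mochizuki2012, status: disputed] -/
theorem effDivAddEquivVal_realifyEff_effDivOfArith_single_inr (w : FinitePlace F) :
    effDivAddEquivVal F (realifyEff F (effDivOfArith F (((Finsupp.single w 1, 0) : EffArithDivisor F)))) =
      @Finsupp.single (Val F) ℝ≥0 _ (Sum.inr w) 1 := by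
  classical
  refine Finsupp.ext fun q => ?_
  rcases q with v | w'
  · rw [effDivAddEquivVal_realifyEff_effDivOfArith_apply_inl]
    delta Val
    rw [Finsupp.single_eq_of_ne Sum.inl_ne_inr]
    rfl
  · rw [effDivAddEquivVal_realifyEff_effDivOfArith_apply_inr]
    delta Val
    simp only [Finsupp.single_apply, Sum.inr.injEq]
    split_ifs <;> simp

/-- **The L1/L5 route on the prime divisor `[v]`** (`v` finite): `e_v⁻¹ ·` the unit vector, i.e.
`[v] ↦ e_v⁻¹ · log⊢_mod(p_v)` (so that `div_v(p_v) = e_v · [v] ↦ log⊢_mod(p_v)`, abc-iut-w4-d050's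
`realifyMod_single_absRamIdx`). ([IUTchI] Ex 3.5 (i) p.84) [claim: Mochizuki2012, status: disputed] -/
theorem realifyMod_single_inr (w : FinitePlace F) :
    EffArithDivisor.realifyMod F (((Finsupp.single w 1, 0) : EffArithDivisor F)) =
      @Finsupp.single (Val F) ℝ≥0 _ (Sum.inr w) ((absRamIdx F w : ℝ≥0)⁻¹) :=
  realifyMod_single_one F w

/-- **The two routes agree on `a ∈ Φ(F)` iff `e_v = 1` at every finite place in the support of `a`.**
([IUTchI] Ex 3.5 (i) p.84) [claim: Mochizuki2012, status: disputed] -/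
theorem effDivAddEquivVal_realifyEff_effDivOfArith_eq_realifyMod_iff (a : EffArithDivisor F) :
    effDivAddEquivVal F (realifyEff F (effDivOfArith F a)) = EffArithDivisor.realifyMod F a ↔
      ∀ w : FinitePlace F, a.1 w ≠ 0 → absRamIdx F w = 1 := by
  constructor
  · intro h w hw
    have hq : ((a.1 w : ℕ) : ℝ≥0) = (a.1 w : ℝ≥0) * ((absRamIdx F w : ℝ≥0)⁻¹) :=
      ((effDivAddEquivVal_realifyEff_effDivOfArith_apply_inr F a w).symm.trans
        (DFunLike.congr_fun h (Sum.inr w : Val F))).trans (realifyMod_apply_inr F a w)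
    -- `n = n · e⁻¹` with `n ≠ 0` forces `e = 1`
    have hn : (a.1 w : ℝ≥0) ≠ 0 := Nat.cast_ne_zero.mpr hw
    have he : ((absRamIdx F w : ℝ≥0))⁻¹ = 1 := by
      have := hq
      rw [eq_comm, mul_right_eq_self₀] at this
      exact this.resolve_right hn
    rw [inv_eq_one] at he
    exact_mod_cast he
  · intro h
    ext q
    rcases q with v | w
    · rw [effDivAddEquivVal_realifyEff_effDivOfArith_apply_inl_eq_realifyMod]
    · rw [effDivAddEquivVal_realifyEff_effDivOfArith_apply_inr, realifyMod_apply_inr]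
      by_cases hw : a.1 w = 0
      · rw [hw, Nat.cast_zero, zero_mul]
      · rw [h w hw, Nat.cast_one, inv_one, mul_one]

/-- **The two routes DIFFER on the prime divisor `[v]` whenever `v` is ramified over `ℚ` (`e_v ≠ 1`).**
([IUTchI] Ex 3.5 (i) p.84) [claim: Mochizuki2012, status: disputed] -/
theorem effDivAddEquivVal_realifyEff_effDivOfArith_single_inr_ne_realifyMod {w : FinitePlace F}
    (hw : absRamIdx F w ≠ 1) :
    effDivAddEquivVal F (realifyEff F (effDivOfArith F (((Finsupp.single w 1, 0) : EffArithDivisor F)))) ≠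
      EffArithDivisor.realifyMod F (((Finsupp.single w 1, 0) : EffArithDivisor F)) := by
  intro h
  rw [effDivAddEquivVal_realifyEff_effDivOfArith_eq_realifyMod_iff] at h
  refine hw (h w ?_)
  change (Finsupp.single w 1 : FinitePlace F →₀ ℕ) w ≠ 0
  rw [Finsupp.single_eq_same]
  exact one_ne_zero

/-! ### At the field of moduli of an initial Θ-datum: `effDivEquivPhiMod` versus `realifyMod_logMod` -/

section InitialTheta

variable {F₀ K Fbar : Type} [Field F₀] [NumberField F₀] [Field K] [NumberField K] [Algebra F₀ K] [Field Fbar]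
  [Algebra F₀ Fbar] [Algebra K Fbar] {E : WeierstrassCurve F₀} [E.IsElliptic] {l : ℕ} {P : BadPlacePredicates K}
  (D : InitialThetaData F₀ K Fbar E l P)

/-- **Under the L6 identification `effDivEquivPhiMod`, the realified PRIME DIVISOR `[v]` of `F_mod` IS `logMod v`**
(abc-iut-L5-t2's `log⊢_mod(p_v)`-unit vector) — to be read next to abc-iut-w4-d050's `realifyMod_logMod`, under which
it is `div_v(p_v) = e_v · [v]` that goes to `logMod v`. ([IUTchI] Ex 3.5 (i) p.84) [claim: Mochizuki2012, status: disputed] -/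
theorem effDivEquivPhiMod_realifyEff_effDivOfArith_single_inr (w : FinitePlace (fieldOfModuli E)) :
    effDivEquivPhiMod D (realifyEff (fieldOfModuli E)
        (effDivOfArith (fieldOfModuli E) (((Finsupp.single w 1, 0) : EffArithDivisor (fieldOfModuli E))))) =
      D.logMod (Sum.inr w) :=
  effDivAddEquivVal_realifyEff_effDivOfArith_single_inr (fieldOfModuli E) w

/-- … equivalently: on `[v]` the L6 identification is `e_v ·` the L1/L5 realification map (`v` finite place of `F_mod`).
([IUTchI] Ex 3.5 (i) p.84) [claim: Mochizuki2012, status: disputed] -/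
theorem effDivEquivPhiMod_realifyEff_effDivOfArith_single_inr_eq_smul_realifyMod (w : FinitePlace (fieldOfModuli E)) :
    effDivEquivPhiMod D (realifyEff (fieldOfModuli E)
        (effDivOfArith (fieldOfModuli E) (((Finsupp.single w 1, 0) : EffArithDivisor (fieldOfModuli E))))) =
      (absRamIdx (fieldOfModuli E) w : ℝ≥0) •
        EffArithDivisor.realifyMod (fieldOfModuli E) (((Finsupp.single w 1, 0) : EffArithDivisor (fieldOfModuli E))) := by
  rw [effDivEquivPhiMod_realifyEff_effDivOfArith_single_inr, realifyMod_single_inr, Finsupp.smul_single,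
    smul_eq_mul, mul_inv_cancel₀ (absRamIdx_cast_ne_zero (fieldOfModuli E) w)]
  rfl

/-- The general coordinatewise form at `F_mod`: `(effDivEquivPhiMod ∘ realifyEff ∘ effDivOfArith)(a)_v = e_v · realifyMod(a)_v`
at a finite `v`. ([IUTchI] Ex 3.5 (i) p.84) [claim: Mochizuki2012, status: disputed] -/
theorem effDivEquivPhiMod_realifyEff_effDivOfArith_apply_inr (a : EffArithDivisor (fieldOfModuli E))
    (w : FinitePlace (fieldOfModuli E)) :
    effDivEquivPhiMod D (realifyEff (fieldOfModuli E) (effDivOfArith (fieldOfModuli E) a)) (Sum.inr w) =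
      (absRamIdx (fieldOfModuli E) w : ℝ≥0) * EffArithDivisor.realifyMod (fieldOfModuli E) a (Sum.inr w) :=
  effDivAddEquivVal_realifyEff_effDivOfArith_apply_inr_eq_absRamIdx_mul_realifyMod (fieldOfModuli E) a w

end InitialTheta

end FrakRlfCat

end Prop37

end Literature.IUT.LogThetaLattice

end
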